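import Literature.Probability.Distributions.EfronMonotonicity
import HarnessLib

/-!
# Efron's theorem under two comparable tilts of the block sum ("lr-tilt domination")

Support file (prover prim-ineq-prove-3 gen 48; `--supports stmt-CriticalPhenomena-4575`; memo
`run/shared/lean/prim/prim-ineq-prove-3/FINDING-G48-INDUCTIVE-CERTIFICATE.md` §2, §6(4)).  No definitions, no sorries.

Setting of `Literature.…EfronMonotonicity`: independent coordinates `X_j ∈ {0,…,N}` with `PF₂` weights `w_j`, the layer functional
`laySum N w K Φ σ = L_K(Φ, σ)`, `Φ` coordinatewise non-decreasing.  If two weight sequences `ω₁, ω₂` (no sign condition is needed) on the values of the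
block sum `S = Σ_{j∈K} X_j` have a NON-DECREASING LIKELIHOOD RATIO `ω₁/ω₂` (cross-multiplied: `ω₁ s · ω₂ s' ≤ ω₁ s' · ω₂ s` for `s ≤ s'`),
then the `ω₁`-tilted mean of `Φ` dominates the `ω₂`-tilted mean, cross-multiplied:
`(Σ_s ω₂ s · L(Φ,s)) · (Σ_s ω₁ s · L(1,s)) ≤ (Σ_s ω₂ s · L(1,s)) · (Σ_s ω₁ s · L(Φ,s))`  (`laySum_tilt_mul_le`).
This contains `efron_prefix_mul_le` (`ω₂ = ω·1[s<c]`, `ω₁ = ω`) and ball monotonicity (`ω₂ = 1[s<σ]`, `ω₁ = 1[s<τ]`, `σ ≤ τ`),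
and is the comparison `E_q[A] ≥ E_λ[A]` between two fuzzy Hamming-ball conditionings used in the cylinder miniature of the memo.
Proof: the symmetrised double sum `Σ_{s,s'} (ω₂ s ω₁ s' − ω₂ s' ω₁ s)(L(1,s)L(Φ,s') − L(Φ,s)L(1,s'))` is termwise `≥ 0` by Efron's
theorem `efron_laySum_mul_le`.
-/

noncomputable section

namespace Summit.CriticalPhenomena.PercolationContinuityZ3.Theorems

namespace SahiOneStep

namespace ProfileGrid

open Finset
open Literature.Probability.Distributions (IsLogConcaveSeq laySum efron_laySum_mul_le)

variable {κ : Type*} [Fintype κ] [DecidableEq κ] {N : ℕ}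

/-- Symmetrisation of a double sum over the same finite range: `Σ_{s,s'} F s s' = Σ_{s,s'} F s' s`. [folklore] -/
theorem sum_sum_range_comm' (F : ℕ → ℕ → ℝ) (M : ℕ) :
    ∑ s ∈ range M, ∑ s' ∈ range M, F s s' = ∑ s ∈ range M, ∑ s' ∈ range M, F s' s := by
  rw [sum_comm]

/-- **Efron under two lr-ordered tilts of the block sum.**  For `PF₂` weights, `Φ` monotone, and real `ω₁, ω₂` with
`ω₁ s · ω₂ s' ≤ ω₁ s' · ω₂ s` whenever `s ≤ s'` (the ratio `ω₁/ω₂` is non-decreasing), the `ω₁`-tilted conditional mean of `Φ`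
dominates the `ω₂`-tilted one, in cross-multiplied form. [this work; cite: Efron1965, Thm 1 (Cor.); SaumardWellner2014, Thm 6.1] -/
theorem laySum_tilt_mul_le (w : κ → ℕ → ℝ) (hw : ∀ j, IsLogConcaveSeq (w j)) (K : Finset κ)
    (Φ : (κ → Fin (N + 1)) → ℝ) (hΦ : Monotone Φ) (ω₁ ω₂ : ℕ → ℝ)
    (hlr : ∀ s s', s ≤ s' → ω₁ s * ω₂ s' ≤ ω₁ s' * ω₂ s) (M : ℕ) :
    (∑ s ∈ range M, ω₂ s * laySum N w K Φ s) * (∑ s ∈ range M, ω₁ s * laySum N w K (fun _ => 1) s) ≤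
      (∑ s ∈ range M, ω₂ s * laySum N w K (fun _ => 1) s) * (∑ s ∈ range M, ω₁ s * laySum N w K Φ s) := by
  set LΦ : ℕ → ℝ := fun s => laySum N w K Φ s with hLΦ
  set L1 : ℕ → ℝ := fun s => laySum N w K (fun _ => 1) s with hL1
  -- the difference as a double sum
  set F : ℕ → ℕ → ℝ := fun s s' => ω₂ s * ω₁ s' * (L1 s * LΦ s' - LΦ s * L1 s') with hF
  have hdiff : (∑ s ∈ range M, ω₂ s * L1 s) * (∑ s ∈ range M, ω₁ s * LΦ s) -
      (∑ s ∈ range M, ω₂ s * LΦ s) * (∑ s ∈ range M, ω₁ s * L1 s) = ∑ s ∈ range M, ∑ s' ∈ range M, F s s' := by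
    rw [sum_mul_sum, sum_mul_sum, ← sum_sub_distrib]
    refine sum_congr rfl fun s _ => ?_
    rw [← sum_sub_distrib]
    refine sum_congr rfl fun s' _ => ?_
    simp only [hF]; ring
  -- each symmetrised term is nonnegative
  have hsym : ∀ s s', 0 ≤ F s s' + F s' s := by
    intro s s'
    have key : F s s' + F s' s = (ω₂ s * ω₁ s' - ω₂ s' * ω₁ s) * (L1 s * LΦ s' - LΦ s * L1 s') := by
      simp only [hF]; ring
    rw [key]
    rcases le_total s s' with hss' | hss'
    · have hA : 0 ≤ ω₂ s * ω₁ s' - ω₂ s' * ω₁ s := by nlinarith [hlr s s' hss']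
      have hB : 0 ≤ L1 s * LΦ s' - LΦ s * L1 s' := by
        have := efron_laySum_mul_le w hw K Φ hΦ hss'
        simp only [hLΦ, hL1]; nlinarith [this]
      exact mul_nonneg hA hB
    · have hA : ω₂ s * ω₁ s' - ω₂ s' * ω₁ s ≤ 0 := by nlinarith [hlr s' s hss']
      have hB : L1 s * LΦ s' - LΦ s * L1 s' ≤ 0 := by
        have := efron_laySum_mul_le w hw K Φ hΦ hss'
        simp only [hLΦ, hL1]; nlinarith [this]
      exact mul_nonneg_of_nonpos_of_nonpos hA hB
  have hpos : 0 ≤ ∑ s ∈ range M, ∑ s' ∈ range M, F s s' := by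
    have h2 : 2 * (∑ s ∈ range M, ∑ s' ∈ range M, F s s') =
        ∑ s ∈ range M, ∑ s' ∈ range M, (F s s' + F s' s) := by
      rw [two_mul]
      conv_lhs => rw [show (∑ s ∈ range M, ∑ s' ∈ range M, F s s') + ∑ s ∈ range M, ∑ s' ∈ range M, F s s' =
        (∑ s ∈ range M, ∑ s' ∈ range M, F s s') + ∑ s ∈ range M, ∑ s' ∈ range M, F s' s from by rw [sum_sum_range_comm' F M]]
      rw [← sum_add_distrib]
      exact sum_congr rfl fun s _ => (sum_add_distrib).symm
    have : 0 ≤ ∑ s ∈ range M, ∑ s' ∈ range M, (F s s' + F s' s) :=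
      sum_nonneg fun s _ => sum_nonneg fun s' _ => hsym s s'
    linarith
  have := hdiff ▸ hpos
  simp only [hLΦ, hL1] at this ⊢
  linarith

/-- **Corollary (two fuzzy balls).**  With `ω₂ = λ` and `ω₁ = q` two level weights such that `q/λ` is non-decreasing (cross-multiplied),
the `q`-tilted mean of a monotone `Φ` dominates the `λ`-tilted mean: `E_λ[Φ] ≤ E_q[Φ]`, cross-multiplied.  (Restatement of
`laySum_tilt_mul_le` with the names used in the memo.) [this work] -/
theorem laySum_tilt_mul_le' (w : κ → ℕ → ℝ) (hw : ∀ j, IsLogConcaveSeq (w j)) (K : Finset κ)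
    (Φ : (κ → Fin (N + 1)) → ℝ) (hΦ : Monotone Φ) (lam q : ℕ → ℝ)
    (hlr : ∀ s s', s ≤ s' → q s * lam s' ≤ q s' * lam s) (M : ℕ) :
    (∑ s ∈ range M, lam s * laySum N w K Φ s) * (∑ s ∈ range M, q s * laySum N w K (fun _ => 1) s) ≤
      (∑ s ∈ range M, lam s * laySum N w K (fun _ => 1) s) * (∑ s ∈ range M, q s * laySum N w K Φ s) :=
  laySum_tilt_mul_le w hw K Φ hΦ q lam hlr M

end ProfileGrid

end SahiOneStep

end Summit.CriticalPhenomena.PercolationContinuityZ3.Theorems
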